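import Summits.HodgeConjecture.HodgeConjecture.Theorems.PadicSemiregularLiftFormalVectorBundlesAlgebraizeFramesLocal
import Mathlib.CategoryTheory.Adjunction.Mates
import Mathlib.CategoryTheory.Adjunction.Unique

/-!
# Frames pull back to frames: the unit of `f^* ⊣ f_*` on sections

Helper file for stub `stub_pushforwardTransport` (line `chow-zariski-pushforward` of the crux
`PadicSemiregularLift.FormalVectorBundlesAlgebraize`, stmt-HodgeConjecture-14106). Mathlib's
inverse image `Scheme.Modules.pullback f` is an abstract left adjoint; this file proves what the
transport stub needs about the unit `η : M → f_* f^* M` on SECTIONS: units compose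
(`pullbackComp_inv_app_unit`, Mathlib `unit_conjugateEquiv`); morphisms `𝒪^ι → L` are tuples of
global sections (`sigma_hom_eval_bijective`); morphisms out of a framed module into a module
supported over the frame's open (`hom_eval_frame_bijective`); and **frames pull back to frames**
(`frame_pullback_unit`: the sections `η(bᵢ)|_W`, `W ≤ f⁻¹U`, form a frame of `f^*M`, by Yoneda on
the open subscheme through the two adjunctions). Everything is proved; no definitions.
-/

noncomputable section

-- Summit.HodgeConjecture.HodgeConjecture.… repeats the summit name by the D-0017 layout (Sub = Summit).
set_option linter.dupNamespace false

open CategoryTheory CategoryTheory.Limits AlgebraicGeometry TopologicalSpace Opposite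
open Literature.AlgebraicGeometry.Modules Literature.AlgebraicGeometry.Motives

universe u

namespace Summit.HodgeConjecture.HodgeConjecture.Theorems.FormalVectorBundlesAlgebraize

namespace PushforwardTransport

variable {X Y Z : Scheme.{u}}

/-! ### Units compose -/

/-- The units of `g^* ⊣ g_*` and `f^* ⊣ f_*` compose to the unit of `(f ≫ g)^* ⊣ (f ≫ g)_*`. -/
theorem unit_comp_unit_eq (f : X ⟶ Y) (g : Y ⟶ Z) (M : Z.Modules) :
    (Scheme.Modules.pullbackPushforwardAdjunction g).unit.app M ≫
      (Scheme.Modules.pushforward g).map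
        ((Scheme.Modules.pullbackPushforwardAdjunction f).unit.app
          ((Scheme.Modules.pullback g).obj M)) ≫
      (Scheme.Modules.pushforwardComp f g).hom.app _ =
    (Scheme.Modules.pullbackPushforwardAdjunction (f ≫ g)).unit.app M ≫
      (Scheme.Modules.pushforward (f ≫ g)).map ((Scheme.Modules.pullbackComp f g).inv.app M) := by
  have h := unit_conjugateEquiv
    ((Scheme.Modules.pullbackPushforwardAdjunction g).comp
      (Scheme.Modules.pullbackPushforwardAdjunction f))
    (Scheme.Modules.pullbackPushforwardAdjunction (f ≫ g))
    (Scheme.Modules.pullbackComp f g).inv M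
  rw [Scheme.Modules.conjugateEquiv_pullbackComp_inv, Adjunction.comp_unit_app] at h
  rw [← Category.assoc]
  exact h

/-- **Units compose on sections**: `pullbackComp⁻¹ (η^{f ≫ g}(m)) = η^f(η^g(m))`. -/
theorem pullbackComp_inv_app_unit (f : X ⟶ Y) (g : Y ⟶ Z) (M : Z.Modules) (U : Z.Opens)
    (m : Γ(M, U)) :
    ((Scheme.Modules.pullbackComp f g).inv.app M).app (f ⁻¹ᵁ (g ⁻¹ᵁ U))
      (((Scheme.Modules.pullbackPushforwardAdjunction (f ≫ g)).unit.app M).app U m) =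
    ((Scheme.Modules.pullbackPushforwardAdjunction f).unit.app
          ((Scheme.Modules.pullback g).obj M)).app (g ⁻¹ᵁ U)
      (((Scheme.Modules.pullbackPushforwardAdjunction g).unit.app M).app U m) := by
  have h' := congrArg (fun φ => φ.app U m) (unit_comp_unit_eq f g M)
  simp only [Scheme.Modules.Hom.comp_app] at h'
  exact h'.symm

/-- **Units compose, on sections**: `pullbackComp (η^f(η^g(m))) = η^{f ≫ g}(m)`. -/
theorem pullbackComp_hom_app_unit_unit (f : X ⟶ Y) (g : Y ⟶ Z) (M : Z.Modules) (U : Z.Opens)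
    (m : Γ(M, U)) :
    ((Scheme.Modules.pullbackComp f g).hom.app M).app (f ⁻¹ᵁ (g ⁻¹ᵁ U))
      (((Scheme.Modules.pullbackPushforwardAdjunction f).unit.app
          ((Scheme.Modules.pullback g).obj M)).app (g ⁻¹ᵁ U)
        (((Scheme.Modules.pullbackPushforwardAdjunction g).unit.app M).app U m)) =
    ((Scheme.Modules.pullbackPushforwardAdjunction (f ≫ g)).unit.app M).app U m := by
  rw [← pullbackComp_inv_app_unit, ← app_comp_apply, ← NatTrans.comp_app, Iso.inv_hom_id]
  rfl

/-- Units along equal morphisms agree, up to Mathlib's `pullbackCongr`. -/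
theorem pullbackCongr_hom_app_unit {f g : X ⟶ Y} (h : f = g) (M : Y.Modules) (U : Y.Opens)
    (m : Γ(M, U)) :
    ((Scheme.Modules.pullbackCongr h).hom.app M).app (g ⁻¹ᵁ U)
      (((Scheme.Modules.pullback f).obj M).presheaf.map
        (eqToHom (show g ⁻¹ᵁ U = f ⁻¹ᵁ U by rw [h])).op
        ((((Scheme.Modules.pullbackPushforwardAdjunction f).unit.app M).app U m))) =
    ((Scheme.Modules.pullbackPushforwardAdjunction g).unit.app M).app U m := by
  subst h
  simp only [eqToHom_refl, op_id, CategoryTheory.Functor.map_id]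
  rfl

/-! ### Morphisms out of `𝒪` and `𝒪^ι` versus global sections -/

/-- A morphism `𝒪 → L` is multiplication by its value on `1`. -/
theorem unitHom_app_eq (L : X.Modules) (g : unitModule X ⟶ L) (O : X.Opens) (r : Γ(X, O)) :
    g.app O r = r • L.presheaf.map (homOfLE (le_top (a := O))).op (g.app ⊤ (1 : Γ(X, ⊤))) := by
  rw [← Scheme.Modules.Hom.app_map_apply, ← Scheme.Modules.Hom.app_smul]
  congr 1
  change r = r * X.presheaf.map _ 1
  rw [map_one]
  exact (mul_one r).symm

/-- Morphisms `𝒪 → L` are determined by their value on the global section `1`. -/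
theorem unitHom_ext (L : X.Modules) (g g' : unitModule X ⟶ L)
    (h : g.app ⊤ (1 : Γ(X, ⊤)) = g'.app ⊤ (1 : Γ(X, ⊤))) : g = g' := by
  refine Scheme.Modules.hom_ext _ _ fun O => ?_
  ext r
  change g.app O r = g'.app O r
  rw [unitHom_app_eq L g, unitHom_app_eq L g', h]

/-- Every global section is the value on `1` of a morphism `𝒪 → L`. -/
theorem exists_unitHom_app_top (L : X.Modules) (l : Γ(L, ⊤)) :
    ∃ g : unitModule X ⟶ L, g.app ⊤ (1 : Γ(X, ⊤)) = l := by
  let sec : L.sections :=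
    PresheafOfModules.sectionsMk (fun O => L.presheaf.map (homOfLE (le_top (a := O.unop))).op l)
      (by
        intro O O' k
        change L.presheaf.map k (L.presheaf.map (homOfLE _).op l) = _
        rw [← CategoryTheory.comp_apply, ← Functor.map_comp]
        rfl)
  refine ⟨L.unitHomEquiv.symm sec, ?_⟩
  have h := SheafOfModules.unitHomEquiv_apply_coe L (L.unitHomEquiv.symm sec) (op (⊤ : X.Opens))
  rw [Equiv.apply_symm_apply] at h
  change L.presheaf.map (homOfLE (le_top (a := (⊤ : X.Opens)))).op l = _ at h
  rw [show L.presheaf.map (homOfLE (le_top (a := (⊤ : X.Opens)))).op l = l from by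
    change (L.presheaf.map (homOfLE (le_refl (⊤ : X.Opens))).op) l = l
    rw [show (homOfLE (le_refl (⊤ : X.Opens))).op = 𝟙 _ from rfl, CategoryTheory.Functor.map_id]
    rfl] at h
  exact h.symm

/-- **Morphisms `𝒪^ι → L` are the `ι`-tuples of global sections of `L`**: evaluation on the
standard frame `ιᵢ(1)` is a bijection. -/
theorem sigma_hom_eval_bijective {ι : Type u} [Fintype ι] (L : X.Modules) :
    Function.Bijective fun ψ : (∐ fun _ : ι => unitModule X) ⟶ L =>
      fun i => ψ.app ⊤ ((Sigma.ι (fun _ : ι => unitModule X) i).app ⊤ (1 : Γ(X, ⊤))) := by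
  constructor
  · intro ψ ψ' h
    refine Sigma.hom_ext _ _ fun i => unitHom_ext L _ _ ?_
    have hi := congrFun h i
    exact hi
  · intro v
    choose g hg using fun i => exists_unitHom_app_top L (v i)
    refine ⟨Sigma.desc g, funext fun i => ?_⟩
    change (Sigma.desc g).app ⊤ _ = v i
    rw [← app_comp_apply, Sigma.ι_desc, hg]

/-- Restriction of a morphism to an open subscheme, on sections. -/
theorem restrictFunctor_map_app {f : X ⟶ Y} [IsOpenImmersion f] {M N : Y.Modules} (ψ : M ⟶ N)
    (O : X.Opens) (y : Γ((Scheme.Modules.restrictFunctor f).obj M, O)) :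
    ((Scheme.Modules.restrictFunctor f).map ψ).app O y = ψ.app (f ''ᵁ O) (show Γ(M, f ''ᵁ O) from y) :=
  rfl

/-- Restriction maps of `M|_f` in terms of those of `M` (elementwise `restrict_map`). -/
theorem restrict_presheaf_map_restrictAppIso_inv (M : Y.Modules) (f : X ⟶ Y) [IsOpenImmersion f]
    {O O' : X.Opens} (k : O' ⟶ O) (y : Γ(M, f ''ᵁ O)) :
    ((Scheme.Modules.restrictFunctor f).obj M).presheaf.map k.op ((M.restrictAppIso f O).inv y) =
      (M.restrictAppIso f O').inv (M.presheaf.map (f.opensFunctor.map k).op y) :=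
  rfl

/-! ### Morphisms out of a framed module into a module supported over the frame's open -/

/-- Restriction along `A ≤ B ≤ A` is bijective on sections. -/
theorem map_bijective_of_le_of_le (L : X.Modules) {A B : X.Opens} (h₁ : A ≤ B) (h₂ : B ≤ A) :
    Function.Bijective (L.presheaf.map (homOfLE h₁).op) :=
  Function.bijective_iff_has_inverse.mpr
    ⟨L.presheaf.map (homOfLE h₂).op, fun x => map_map_of_le_of_le L h₂ h₁ x,
      fun x => map_map_of_le_of_le L h₁ h₂ x⟩

/-- Precomposition with `β` bijective on `Hom(-, L)` for all `L` makes `β` an isomorphism. -/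
theorem isIso_of_comp_bijective {C : Type*} [Category C] {A B : C} (β : A ⟶ B)
    (h : ∀ L : C, Function.Bijective fun χ : B ⟶ L => β ≫ χ) : IsIso β := by
  obtain ⟨r, hr⟩ := (h A).2 (𝟙 A)
  refine ⟨⟨r, hr, (h B).1 ?_⟩⟩
  change β ≫ r ≫ β = β ≫ 𝟙 B
  rw [← Category.assoc, show β ≫ r = 𝟙 A from hr, Category.id_comp, Category.comp_id]

/-- **Morphisms out of a framed module.** Let `b` be a frame of `M` over `U` and let `P` be
*supported over `U`*: every restriction `Γ(P, O) → Γ(P, U ∩ O)` (the unit of `restrictAdjunction U.ι`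
at `P`) is bijective. Then `φ : M → P` is the same as the tuple `(φ(bᵢ))ᵢ` of sections over `U`. -/
theorem hom_eval_frame_bijective {ι : Type u} [Fintype ι] {M P : X.Modules} {U : X.Opens}
    (b : ι → Γ(M, U))
    (hb : ∀ (V : X.Opens) (hV : V ≤ U), Function.Bijective fun a : ι → Γ(X, V) =>
      ∑ i, a i • M.presheaf.map (homOfLE hV).op (b i))
    (hP : ∀ O : X.Opens,
      Function.Bijective (P.presheaf.map (homOfLE (U.ι.image_preimage_le O)).op)) :
    Function.Bijective fun φ : M ⟶ P => fun i => φ.app U (b i) := by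
  -- the unit of the restriction adjunction at `P` is an isomorphism
  have hunit : IsIso ((Scheme.Modules.restrictAdjunction U.ι).unit.app P) := by
    refine Scheme.Modules.Hom.isIso_iff_isIso_app.mpr fun O => ?_
    rw [Scheme.Modules.restrictAdjunction_unit_app_app]
    exact (ConcreteCategory.isIso_iff_bijective _).mpr (hP O)
  let uP : P ≅ (Scheme.Modules.pushforward U.ι).obj ((Scheme.Modules.restrictFunctor U.ι).obj P) :=
    @asIso _ _ _ _ ((Scheme.Modules.restrictAdjunction U.ι).unit.app P) hunit
  -- the trivialisation of `M|_U`
  obtain ⟨σ, hσ⟩ := exists_sigmaIso_of_frame_top _ (frame_restrict_top_of_frame M U b hb)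
  -- the chain of bijections
  let e1 : (M ⟶ P) →
      (M ⟶ (Scheme.Modules.pushforward U.ι).obj ((Scheme.Modules.restrictFunctor U.ι).obj P)) :=
    fun φ => φ ≫ uP.hom
  let e2 : (M ⟶ (Scheme.Modules.pushforward U.ι).obj ((Scheme.Modules.restrictFunctor U.ι).obj P)) →
      ((Scheme.Modules.restrictFunctor U.ι).obj M ⟶ (Scheme.Modules.restrictFunctor U.ι).obj P) :=
    fun ψ => ((Scheme.Modules.restrictAdjunction U.ι).homEquiv M _).symm ψ
  let e3 : ((Scheme.Modules.restrictFunctor U.ι).obj M ⟶ (Scheme.Modules.restrictFunctor U.ι).obj P) →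
      ((∐ fun _ : ι => unitModule (U : Scheme.{u})) ⟶ (Scheme.Modules.restrictFunctor U.ι).obj P) :=
    fun χ => σ.hom ≫ χ
  let e4 : ((∐ fun _ : ι => unitModule (U : Scheme.{u})) ⟶ (Scheme.Modules.restrictFunctor U.ι).obj P) →
      ι → Γ((Scheme.Modules.restrictFunctor U.ι).obj P, ⊤) :=
    fun ψ i => ψ.app ⊤ ((Sigma.ι (fun _ : ι => unitModule (U : Scheme.{u})) i).app ⊤
      (1 : Γ((U : Scheme.{u}), ⊤)))
  let e5 : Γ((Scheme.Modules.restrictFunctor U.ι).obj P, ⊤) → Γ(P, U) := fun y =>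
    P.presheaf.map (homOfLE (U.ι_image_top).ge).op ((P.restrictAppIso U.ι ⊤).hom y)
  have h1 : Function.Bijective e1 := Function.bijective_iff_has_inverse.mpr
    ⟨fun ψ => ψ ≫ uP.inv, fun φ => by simp [e1], fun ψ => by simp [e1]⟩
  have h2 : Function.Bijective e2 := ((Scheme.Modules.restrictAdjunction U.ι).homEquiv M _).symm.bijective
  have h3 : Function.Bijective e3 := Function.bijective_iff_has_inverse.mpr
    ⟨fun ψ => σ.inv ≫ ψ, fun χ => by simp [e3], fun ψ => by simp [e3]⟩
  have h4 : Function.Bijective e4 := sigma_hom_eval_bijective _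
  have h5 : Function.Bijective e5 :=
    (map_bijective_of_le_of_le P (U.ι_image_top).ge (U.ι_image_top).le).comp
      ⟨fun _ _ h => h, fun y => ⟨y, rfl⟩⟩
  have h5' : Function.Bijective fun v : ι → Γ((Scheme.Modules.restrictFunctor U.ι).obj P, ⊤) =>
      fun i => e5 (v i) :=
    (Equiv.piCongrRight fun _ : ι => Equiv.ofBijective e5 h5).bijective
  have key : (fun φ : M ⟶ P => fun i => φ.app U (b i)) =
      (fun v : ι → Γ((Scheme.Modules.restrictFunctor U.ι).obj P, ⊤) => fun i => e5 (v i)) ∘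
        e4 ∘ e3 ∘ e2 ∘ e1 := by
    funext φ i
    -- `e2 (e1 φ)` is just the restriction of `φ` (a triangle identity)
    have hφ : ((Scheme.Modules.restrictAdjunction U.ι).homEquiv M _).symm
        (φ ≫ (Scheme.Modules.restrictAdjunction U.ι).unit.app P) =
        (Scheme.Modules.restrictFunctor U.ι).map φ := by
      rw [Adjunction.homEquiv_naturality_left_symm, ← Adjunction.homEquiv_id,
        Equiv.symm_apply_apply, Category.comp_id]
    change φ.app U (b i) = P.presheaf.map (homOfLE (U.ι_image_top).ge).op
      ((P.restrictAppIso U.ι ⊤).hom ((σ.hom ≫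
        ((Scheme.Modules.restrictAdjunction U.ι).homEquiv M _).symm
          (φ ≫ (Scheme.Modules.restrictAdjunction U.ι).unit.app P)).app ⊤
        ((Sigma.ι (fun _ : ι => unitModule (U : Scheme.{u})) i).app ⊤ (1 : Γ((U : Scheme.{u}), ⊤)))))
    rw [hφ, app_comp_apply, hσ, restrictFunctor_map_app]
    change φ.app U (b i) = P.presheaf.map (homOfLE (U.ι_image_top).ge).op
      (φ.app (U.ι ''ᵁ ⊤) (M.presheaf.map (homOfLE (U.ι_image_top).le).op (b i)))
    rw [Scheme.Modules.Hom.app_map_apply, map_map_of_le_of_le]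
  rw [key]
  exact h5'.comp (h4.comp (h3.comp (h2.comp h1)))

/-! ### Frames pull back to frames -/

/-- **Frames pull back to frames.** For `f : T → X`, a frame `b` of `M` over `U` and an open
`W ≤ f⁻¹U`, the sections `η(bᵢ)|_W` of `f^*M` (`η` the unit of `f^* ⊣ f_*`) form a frame of `f^*M`
over `W` (for `V ≤ W`, `𝒪_V^ι → (f^*M)|_V` is an isomorphism by Yoneda:
`Hom((f^*M)|_V, L) = Hom(M, f_* ι_{V*} L) ≅ Γ(L, ⊤)^ι` by `hom_eval_frame_bijective`). -/
theorem frame_pullback_unit {T : Scheme.{u}} (f : T ⟶ X) (M : X.Modules) {U : X.Opens}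
    {ι : Type u} [Fintype ι] (b : ι → Γ(M, U))
    (hb : ∀ (V : X.Opens) (hV : V ≤ U), Function.Bijective fun a : ι → Γ(X, V) =>
      ∑ i, a i • M.presheaf.map (homOfLE hV).op (b i))
    {W : T.Opens} (hW : W ≤ f ⁻¹ᵁ U) :
    ∀ (V : T.Opens) (hV : V ≤ W), Function.Bijective fun a : ι → Γ(T, V) =>
      ∑ i, a i • ((Scheme.Modules.pullback f).obj M).presheaf.map (homOfLE hV).op
        (((Scheme.Modules.pullback f).obj M).presheaf.map (homOfLE hW).op
          ((((Scheme.Modules.pullbackPushforwardAdjunction f).unit.app M).app U (b i)))) := by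
  intro V hV
  let N := (Scheme.Modules.pullback f).obj M
  let η := (Scheme.Modules.pullbackPushforwardAdjunction f).unit.app M
  let n : ι → Γ(N, f ⁻¹ᵁ U) := fun i => η.app U (b i)
  have hVU : V ≤ f ⁻¹ᵁ U := hV.trans hW
  -- the candidate frame of `N|_V` over `⊤`
  let NV := (Scheme.Modules.restrictFunctor V.ι).obj N
  have hVU' : V.ι ''ᵁ ⊤ ≤ f ⁻¹ᵁ U := (V.ι_image_top).le.trans hVU
  let nV : ι → Γ(NV, ⊤) := fun i =>
    (N.restrictAppIso V.ι ⊤).inv (N.presheaf.map (homOfLE hVU').op (n i))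
  -- Step 1: morphisms `N|_V → L` are classified by their values on `nV`
  have hΨ : ∀ L : (V : Scheme.{u}).Modules,
      Function.Bijective fun χ : NV ⟶ L => fun i => χ.app ⊤ (nV i) := by
    intro L
    let adjV := Scheme.Modules.restrictAdjunction V.ι
    let adjf := Scheme.Modules.pullbackPushforwardAdjunction f
    let P : X.Modules :=
      (Scheme.Modules.pushforward f).obj ((Scheme.Modules.pushforward V.ι).obj L)
    -- `P` is supported over `U`: its sections over `O` and over `U ∩ O` are the sections of `L`
    -- over two equal opens of `V`
    have hP : ∀ O : X.Opens,
        Function.Bijective (P.presheaf.map (homOfLE (U.ι.image_preimage_le O)).op) := by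
      intro O
      have hle : V.ι ⁻¹ᵁ (f ⁻¹ᵁ O) ≤ V.ι ⁻¹ᵁ (f ⁻¹ᵁ (U.ι ''ᵁ U.ι ⁻¹ᵁ O)) := by
        intro v hv
        change f.base (V.ι.base v) ∈ U.ι ''ᵁ U.ι ⁻¹ᵁ O
        rw [Scheme.Hom.image_preimage_eq_opensRange_inf, Scheme.Opens.opensRange_ι]
        exact ⟨hVU (show V.ι.base v ∈ V from v.2), hv⟩
      have hge : V.ι ⁻¹ᵁ (f ⁻¹ᵁ (U.ι ''ᵁ U.ι ⁻¹ᵁ O)) ≤ V.ι ⁻¹ᵁ (f ⁻¹ᵁ O) :=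
        fun v hv => U.ι.image_preimage_le O hv
      have heq : (P.presheaf.map (homOfLE (U.ι.image_preimage_le O)).op : Γ(P, O) → _) =
          L.presheaf.map (homOfLE hge).op := by
        funext y
        exact presheaf_map_congr L _ _ y
      rw [heq]
      exact map_bijective_of_le_of_le L hge hle
    -- the chain `Hom(N|_V, L) ≃ Hom(N, ι_*L) ≃ Hom(M, P) ≃ Γ(P, U)^ι`
    let a1 : (NV ⟶ L) → (N ⟶ (Scheme.Modules.pushforward V.ι).obj L) :=
      fun χ => adjV.homEquiv N L χ
    let a2 : (N ⟶ (Scheme.Modules.pushforward V.ι).obj L) → (M ⟶ P) :=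
      fun ψ => adjf.homEquiv M _ ψ
    let a3 : (M ⟶ P) → ι → Γ(P, U) := fun φ i => φ.app U (b i)
    have h123 : Function.Bijective (a3 ∘ a2 ∘ a1) :=
      (hom_eval_frame_bijective b hb hP).comp
        ((adjf.homEquiv M _).bijective.comp (adjV.homEquiv N L).bijective)
    -- `Γ(P, U) = Γ(L, V ∩ f⁻¹U)` is `Γ(L, ⊤)`
    have htop : (⊤ : (V : Scheme.{u}).Opens) ≤ V.ι ⁻¹ᵁ (f ⁻¹ᵁ U) :=
      fun v _ => hVU (show V.ι.base v ∈ V from v.2)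
    let g : (ι → Γ(L, ⊤)) → ι → Γ(P, U) := fun v i =>
      L.presheaf.map (homOfLE (le_top (a := V.ι ⁻¹ᵁ (f ⁻¹ᵁ U)))).op (v i)
    have hg : Function.Bijective g :=
      (Equiv.piCongrRight fun _ : ι =>
        Equiv.ofBijective _ (map_bijective_of_le_of_le L le_top htop)).bijective
    have hcomp : g ∘ (fun χ : NV ⟶ L => fun i => χ.app ⊤ (nV i)) = a3 ∘ a2 ∘ a1 := by
      funext χ i
      change L.presheaf.map (homOfLE (le_top (a := V.ι ⁻¹ᵁ (f ⁻¹ᵁ U)))).op (χ.app ⊤ (nV i)) =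
        ((Scheme.Modules.pullbackPushforwardAdjunction f).homEquiv M _
          ((Scheme.Modules.restrictAdjunction V.ι).homEquiv N L χ)).app U (b i)
      rw [← Scheme.Modules.Hom.app_map_apply, Adjunction.homEquiv_unit, Adjunction.homEquiv_unit]
      have h1 : (((Scheme.Modules.pullbackPushforwardAdjunction f).unit.app M ≫
          (Scheme.Modules.pushforward f).map
            ((Scheme.Modules.restrictAdjunction V.ι).unit.app N ≫
              (Scheme.Modules.pushforward V.ι).map χ)).app U : Γ(M, U) → _) =
          fun m => χ.app (V.ι ⁻¹ᵁ (f ⁻¹ᵁ U))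
            (((Scheme.Modules.restrictAdjunction V.ι).unit.app N).app (f ⁻¹ᵁ U)
              (((Scheme.Modules.pullbackPushforwardAdjunction f).unit.app M).app U m)) := rfl
      refine Eq.trans ?_ (congrFun h1 (b i)).symm
      change _ = χ.app (V.ι ⁻¹ᵁ (f ⁻¹ᵁ U))
        (((Scheme.Modules.restrictAdjunction V.ι).unit.app N).app (f ⁻¹ᵁ U) (n i))
      rw [Scheme.Modules.restrictAdjunction_unit_app_app]
      congr 1
      change NV.presheaf.map (homOfLE (le_top (a := V.ι ⁻¹ᵁ (f ⁻¹ᵁ U)))).op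
        ((N.restrictAppIso V.ι ⊤).inv (N.presheaf.map (homOfLE hVU').op (n i))) =
        (N.restrictAppIso V.ι (V.ι ⁻¹ᵁ (f ⁻¹ᵁ U))).inv
          (N.presheaf.map (homOfLE (V.ι.image_preimage_le (f ⁻¹ᵁ U))).op (n i))
      rw [restrict_presheaf_map_restrictAppIso_inv]
      congr 1
      rw [← CategoryTheory.comp_apply, ← Functor.map_comp]
      exact presheaf_map_congr N _ _ (n i)
    rw [← hcomp] at h123
    exact (Function.Bijective.of_comp_iff' hg _).mp h123
  -- Step 2: the morphism `𝒪_V^ι → N|_V` defined by `nV`, an isomorphism by Yoneda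
  obtain ⟨β, hβ⟩ := (sigma_hom_eval_bijective (ι := ι) NV).2 nV
  haveI hβiso : IsIso β := isIso_of_comp_bijective β fun L => by
    have hcomp : (fun ψ : (∐ fun _ : ι => unitModule (V : Scheme.{u})) ⟶ L => fun i =>
        ψ.app ⊤ ((Sigma.ι (fun _ : ι => unitModule (V : Scheme.{u})) i).app ⊤
          (1 : Γ((V : Scheme.{u}), ⊤)))) ∘ (fun χ : NV ⟶ L => β ≫ χ) =
        fun χ : NV ⟶ L => fun i => χ.app ⊤ (nV i) := by
      funext χ i
      change (β ≫ χ).app ⊤ _ = _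
      rw [app_comp_apply, show β.app ⊤ ((Sigma.ι (fun _ : ι => unitModule (V : Scheme.{u})) i).app
        ⊤ (1 : Γ((V : Scheme.{u}), ⊤))) = nV i from congrFun hβ i]
    have h := hΨ L
    rw [← hcomp] at h
    exact (Function.Bijective.of_comp_iff' (sigma_hom_eval_bijective (ι := ι) L) _).mp h
  -- Step 3: so `nV` is a frame of `N|_V` over `⊤`, i.e. of `N` over `V`
  have hfr : ∀ (O : (V : Scheme.{u}).Opens) (hO : O ≤ ⊤), Function.Bijective
      fun a : ι → Γ((V : Scheme.{u}), O) => ∑ i, a i • NV.presheaf.map (homOfLE hO).op (nV i) := by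
    have h := frame_map_iso (asIso β) _ (frame_sigmaι (X := (V : Scheme.{u})) (ι := ι) ⊤)
    intro O hO
    have h' := h O hO
    have heq : ∀ i, (asIso β).hom.app ⊤ ((Sigma.ι (fun _ : ι => unitModule (V : Scheme.{u})) i).app
        ⊤ (1 : Γ((V : Scheme.{u}), ⊤))) = nV i := fun i => congrFun hβ i
    simp_rw [heq] at h'
    exact h'
  have h6 := frame_of_frame_restrict_top N V nV hfr V le_rfl
  have heq : ∀ i, N.presheaf.map (homOfLE (le_refl V)).op (N.presheaf.map
      (homOfLE (V.ι_image_top).ge).op ((N.restrictAppIso V.ι ⊤).hom (nV i))) =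
      N.presheaf.map (homOfLE hV).op (N.presheaf.map (homOfLE hW).op (n i)) := by
    intro i
    have hid : (N.restrictAppIso V.ι ⊤).hom (nV i) = N.presheaf.map (homOfLE hVU').op (n i) := rfl
    rw [hid]
    simp only [← CategoryTheory.comp_apply, ← Functor.map_comp]
    exact presheaf_map_congr N _ _ (n i)
  simp_rw [heq] at h6
  exact h6

end PushforwardTransport

/-! ### Registered sub-goal -/

/-- **Registered sub-goal** (helper stub of `stub_pushforwardTransport`, universe `0`): frames pull
back to frames along the unit of `f^* ⊣ f_*` (`frame_pullback_unit`). -/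
theorem stub_framePullbackUnit :
    ∀ (T X : AlgebraicGeometry.Scheme.{0}) (f : T ⟶ X) (M : X.Modules) (U : X.Opens) (ι : Type)
      [Fintype ι] (b : ι → M.presheaf.obj (Opposite.op U)),
      (∀ (V : X.Opens) (hV : V ≤ U), Function.Bijective fun a : ι → X.presheaf.obj (Opposite.op V) =>
        ∑ i, a i • M.presheaf.map (CategoryTheory.homOfLE hV).op (b i)) →
      ∀ (W : T.Opens) (hW : W ≤ f ⁻¹ᵁ U) (V : T.Opens) (hV : V ≤ W),
        Function.Bijective fun a : ι → T.presheaf.obj (Opposite.op V) =>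
          ∑ i, a i • ((AlgebraicGeometry.Scheme.Modules.pullback f).obj M).presheaf.map
            (CategoryTheory.homOfLE hV).op
            (((AlgebraicGeometry.Scheme.Modules.pullback f).obj M).presheaf.map
              (CategoryTheory.homOfLE hW).op
              ((((AlgebraicGeometry.Scheme.Modules.pullbackPushforwardAdjunction f).unit.app M).app
                U (b i)))) :=
  fun _ _ f M _ _ _ b hb _ hW => PushforwardTransport.frame_pullback_unit f M b hb hW

end Summit.HodgeConjecture.HodgeConjecture.Theorems.FormalVectorBundlesAlgebraize

end
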